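import Summits.BirchSwinnertonDyer.Rank1Residual.GaloisImage.ThreeAdicFrobeniusWitness
import Summits.BirchSwinnertonDyer.Rank1Residual.GaloisImage.NineTorsionOrderNineWitness
import Literature.NumberTheory.EllipticCurves.TateModuleFree
import HarnessLib

/-!
# F0's ORDER-NINE Frobenius from two integers: `σ³ = 1` on `E[3]` and `σ³ ≠ 1` on `E[9]` read off
# `(ℓ, a_ℓ)` to 3-adic precision `81` (cell `b2b-bsdres`, team n1011, seat p10 gen 6 — row
# T-b11-TINST FILE 0, a TOOL file (lead R5-68 ADD. 1 (x): no objection; FROB9 PART 2 stays parked))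

HONEST FRAMING (cell `b2b-bsdres`, run/shared/lean/b2b/bsd-rank1-residual/, verbatim in every file):
the goal of the cell is to DELETE the COMBINATION-SHAPED residual classes of the Birch–Swinnerton-Dyer
formula for ALL analytic-rank `≤ 1` elliptic curves over `ℚ` — "full BSD formula for every rank `≤ 1`
curve in class `C`" assembled STRICTLY from published theorems — so that the rank-`≤ 1` remainder
becomes exactly the CONSTRUCTION-SHAPED classes, which are TYPED (missing-input `Prop`s), NOT
attempted. This is not "finishing BSD". Team n1011 (N10 / N11): research route; no claim beyond the
stated classes; labels UNCHANGED; nothing is booked. Theorems only (no definition, no named fact).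

## What this file proves

n1011-p02's F0 (`towerSurj_three_of_surj_of_orderNine`, `GaloisImage/NineTorsionOrderNineWitness`)
turns surj(3) plus ONE `τ ∈ Γ_ℚ` with `τ³ = 1` on `E[3]` (h3) and `τ³ ≠ 1` on `E[9]` (h9) into the
whole `3`-adic tower.  Here (h3) and (h9) are obtained from the trace `t` and determinant `d` of `τ`
on the Tate module `T₃E` ALONE, provided `t ≡ 2`, `d ≡ 1 (mod 3)` and `81 ∤ d³ + 1 − t³ + 3td`:

* Cayley–Hamilton `G² = tG − d` for the matrix `G` of `τ` gives `G³ − 1 = (t² − d)G − (td + 1) =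
  3·X`, so `τ³` acts on `E[3] = T₃E/3T₃E` trivially (`smul_eq_of_toMatrix_eq_one_add_smul`) — (h3);
* if `τ³` acted trivially on `E[9] = T₃E/9T₃E`, every entry of `G³ − 1` would lie in `9ℤ₃`
  (`pow_dvd_toMatrix_sub_one_apply_of_forall_smul_eq`: the kernel of `T₃E → E[9]` is `9T₃E`), so
  `81 ∣ det(G³ − 1) = (t² − d)²d − (t² − d)(td + 1)t + (td + 1)² = d³ + 1 − t³ + 3td` — (h9) by
  contraposition (`pow_three_smul_eq_and_exists_ne_of_traceCert`).

For an arithmetic Frobenius `φ` at a good prime `ℓ ≠ 3` (`t = a_ℓ`, `d = ℓ`: Silverman C.21.3, tree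
theorems `trace_galoisRepTate_frobenius_eq_frobeniusTrace` / `det_…_of_hasGoodReductionAt_holds`)
this is a ONE-PRIME certificate: `τ = φ` when `(a_ℓ, ℓ) ≡ (2, 1) (mod 3)`, `τ = φ²` when
`(a_ℓ, ℓ) ≡ (1, 1)` (`(t, d) = (a_ℓ² − 2ℓ, ℓ²)`); integer-model readings `…_of_intModel_of_traceCert[Sq]`.
`27 ∣ det(G³ − 1)` always holds in these classes — the certificate lives one `3`-adic digit deeper,
which the INTEGER `a_ℓ` supplies; the classes of order `2, 4, 8` mod `3` admit NO such certificate
(Elkies' group contains `4·I`; note `HOME/b2b-bsdres-n1011-p10/g6/ORDER9-TRACE-CERT-NOTE.md`).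
Nothing booked; no label change.

References: [SerreAbelianLadic1968] IV-23 Lemma 3; [Elkies2006] §1; [SilvermanAEC2009] III.§7,
C.21.3; [Kato2004Asterisque] (12.5.2) p. 222.
-/

noncomputable section

open scoped Classical

open WeierstrassCurve Field Literature.NumberTheory.EllipticCurves
  Literature.NumberTheory.GaloisRepresentations NumberField IsDedekindDomain Rat.HeightOneSpectrum
  Summit.BirchSwinnertonDyer.BirchSwinnertonDyer.Rank1Residual.IntModel

namespace Summit.BirchSwinnertonDyer.Rank1Residual.GaloisImage

section Algebra

variable {R : Type*} [CommRing R]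

/-- Cayley–Hamilton for `2 × 2` matrices: `G² = tr(G) G - det(G)`. [folklore] -/
private theorem mat_mul_self_eq' (G : Matrix (Fin 2) (Fin 2) R) :
    G * G = G.trace • G - G.det • (1 : Matrix (Fin 2) (Fin 2) R) := by
  rw [Matrix.trace_fin_two, Matrix.det_fin_two]
  ext i j
  fin_cases i <;> fin_cases j <;>
    simp only [Matrix.sub_apply, Matrix.smul_apply, Matrix.mul_apply, Fin.sum_univ_two,
      Matrix.one_fin_two, Matrix.of_apply, Matrix.cons_val', Matrix.cons_val_zero,
      Matrix.cons_val_one, Matrix.empty_val', Matrix.cons_val_fin_one, Fin.zero_eta, Fin.mk_one,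
      Fin.isValue, smul_eq_mul] <;> ring

/-- `G³ − 1 = (t² − d) G − (t d + 1)` for a `2 × 2` matrix with `G² = tG − d`. [folklore] -/
private theorem pow_three_sub_one_eq (G : Matrix (Fin 2) (Fin 2) R) {t d : R}
    (hG : G * G = t • G - d • (1 : Matrix (Fin 2) (Fin 2) R)) :
    G ^ 3 - 1 = (t * t - d) • G - (t * d + 1) • (1 : Matrix (Fin 2) (Fin 2) R) := by
  have h3 : G ^ 3 = G * (G * G) := by rw [pow_succ, pow_two, mul_assoc]
  rw [h3, hG, mul_sub, Matrix.mul_smul, Matrix.mul_smul, mul_one, hG, smul_sub, smul_smul,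
    smul_smul]
  module

/-- `det(x G − y·1) = x² det G − x y tr G + y²` for a `2 × 2` matrix. [folklore] -/
private theorem det_smul_sub_smul_one (G : Matrix (Fin 2) (Fin 2) R) (x y : R) :
    (x • G - y • (1 : Matrix (Fin 2) (Fin 2) R)).det = x ^ 2 * G.det - x * y * G.trace + y ^ 2 := by
  rw [Matrix.det_fin_two, Matrix.det_fin_two, Matrix.trace_fin_two]
  simp only [Matrix.sub_apply, Matrix.smul_apply, Matrix.one_apply_eq, Matrix.one_apply_ne,
    ne_eq, zero_ne_one, one_ne_zero, not_false_eq_true, smul_eq_mul, mul_one, mul_zero, sub_zero,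
    Fin.isValue]
  ring

/-- The trace of `G²` for a `2 × 2` matrix with `G² = tG − d`: `t² − 2d`. [folklore] -/
private theorem trace_mul_self_eq (G : Matrix (Fin 2) (Fin 2) R) {t d : R}
    (hG : G * G = t • G - d • (1 : Matrix (Fin 2) (Fin 2) R)) (ht : G.trace = t) :
    (G * G).trace = t * t - 2 * d := by
  rw [hG, Matrix.trace_sub, Matrix.trace_smul, Matrix.trace_smul, ht, Matrix.trace_one,
    Fintype.card_fin]
  simp only [smul_eq_mul, Nat.cast_ofNat]
  ring

end Algebra

section Tate

variable {K : Type*} [Field K] (W : WeierstrassCurve K) (p : ℕ) [Fact p.Prime]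

/-- `ker (T_p E → E[p^k]) = p^k T_p E` (iterate `TateModule.p_smul_div`; private copy of the lemma in
`TateModuleBigImageOfSurjectiveProofs`, whose imports are not wanted here). Silverman III.§7. [folklore] -/
private theorem exists_eq_pow_smul_of_proj_eq_zero (k : ℕ) (a : W.tateModule p)
    (h : TateModule.proj p k a = 0) : ∃ c : W.tateModule p, a = ((p : ℤ_[p]) ^ k) • c := by
  induction k generalizing a with
  | zero => exact ⟨a, by rw [pow_zero, one_smul]⟩
  | succ k ih =>
    have h1 : TateModule.proj p 1 a = 0 := by
      rw [← TateModule.pow_smul_proj_self_add k 1 a, h, smul_zero]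
    have hb : TateModule.proj p k (TateModule.div a h1) = 0 := by rw [TateModule.proj_div]; exact h
    obtain ⟨c, hc⟩ := ih (TateModule.div a h1) hb
    refine ⟨c, ?_⟩
    rw [← TateModule.p_smul_div a h1, hc, smul_smul, pow_succ']

/-- **A matrix congruent to `1` modulo `p` acts trivially on `E[p]`**: if `τ ∈ Γ_K` has matrix `1 + p X`
on `T_p E`, then `τ • P = P` for every `P ∈ E[p]` (`P = a_1` for some `a ∈ T_p E` by
`proj_surjective_of_isAlgClosed_holds`, and `(p • Y)_1 = 0`). Silverman III.§7. [folklore] -/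
theorem smul_eq_of_toMatrix_eq_one_add_smul [W.IsElliptic]
    (b : Module.Basis (Fin 2) ℤ_[p] (W.tateModule p))
    (τ : absoluteGaloisGroup K) (X : Matrix (Fin 2) (Fin 2) ℤ_[p])
    (hτ : LinearMap.toMatrix b b (W.galoisRepTate p τ) = 1 + (p : ℤ_[p]) • X)
    (P : geomPoints W) (hP : P ∈ geomTorsion W (p : ℤ)) : τ • P = P := by
  have hP' : P ∈ geomTorsion W (p ^ 1 : ℕ) := by rwa [pow_one]
  obtain ⟨a, rfl⟩ := proj_surjective_of_isAlgClosed_holds W p 1 hP'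
  have hlin : W.galoisRepTate p τ = LinearMap.id + (p : ℤ_[p]) • Matrix.toLin b b X := by
    have := congrArg (Matrix.toLin b b) hτ
    rwa [Matrix.toLin_toMatrix, map_add, map_smul, Matrix.toLin_one] at this
  have hact : τ • a = a + (p : ℤ_[p]) • Matrix.toLin b b X a := by
    rw [← galoisRepTate_apply_apply, hlin]
    rfl
  have h0 : p • TateModule.proj p 1 (Matrix.toLin b b X a) = 0 := by
    simpa only [pow_one] using TateModule.pow_smul_proj 1 (Matrix.toLin b b X a)
  rw [← TateModule.proj_smul_of_distribMulAction, hact, map_add, TateModule.proj_natCast_smul, h0,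
    add_zero]

/-- **Trivial action on `E[p^k]` forces the matrix to be `≡ 1 (mod p^k)`**: if `τ ∈ Γ_K` fixes `E[p^k]`
pointwise, every entry of `M(τ) − 1` is divisible by `p ^ k` (the `j`-th column holds the coordinates
of `τ bⱼ − bⱼ`, whose `k`-th component vanishes, so `τ bⱼ − bⱼ ∈ p^k T_p E`). Silverman III.§7. [folklore] -/
theorem pow_dvd_toMatrix_sub_one_apply_of_forall_smul_eq
    (b : Module.Basis (Fin 2) ℤ_[p] (W.tateModule p)) (τ : absoluteGaloisGroup K) (k : ℕ)
    (hfix : ∀ Q ∈ geomTorsion W ((p ^ k : ℕ) : ℤ), τ • Q = Q) (i j : Fin 2) :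
    (p : ℤ_[p]) ^ k ∣ (LinearMap.toMatrix b b (W.galoisRepTate p τ) - 1) i j := by
  have hx : TateModule.proj p k (W.galoisRepTate p τ (b j) - b j) = 0 := by
    rw [map_sub, galoisRepTate_apply_apply, TateModule.proj_smul_of_distribMulAction,
      hfix _ (proj_tateModule_mem_geomTorsion W p k (b j)), sub_self]
  obtain ⟨c, hc⟩ := exists_eq_pow_smul_of_proj_eq_zero W p k _ hx
  refine ⟨b.repr c i, ?_⟩
  rw [← LinearMap.toMatrix_one (v₁ := b), ← map_sub, LinearMap.toMatrix_apply, LinearMap.sub_apply,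
    Module.End.one_apply, hc, map_smul, Finsupp.smul_apply, smul_eq_mul]

end Tate

section Three

/-- `81 ∣ x` in `ℤ₃` for an integer `x` means `81 ∣ x` in `ℤ`. [folklore] -/
private theorem int_dvd_of_padicInt_dvd {x : ℤ} (h : (3 : ℤ_[3]) ^ 4 ∣ (x : ℤ_[3])) :
    (81 : ℤ) ∣ x := by
  haveI : Fact (Nat.Prime 3) := ⟨Nat.prime_three⟩
  have hmem : (x : ℤ_[3]) ∈ (Ideal.span {((3 : ℕ) : ℤ_[3]) ^ 4} : Ideal ℤ_[3]) :=
    Ideal.mem_span_singleton.mpr (by exact_mod_cast h)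
  have hnorm := (PadicInt.norm_le_pow_iff_mem_span_pow (p := 3) (x : ℤ_[3]) 4).mpr hmem
  have hdvd := (PadicInt.norm_int_le_pow_iff_dvd (p := 3) (k := x) (n := 4)).mp hnorm
  norm_num at hdvd
  exact hdvd

variable (W : WeierstrassCurve ℚ) [W.IsElliptic]

/-- **F0's hypotheses from trace and determinant on `T₃E`**: if `τ ∈ Γ_ℚ` acts on `T₃E` with matrix `G`,
`tr G = t`, `det G = d`, `3 ∣ t + 1`, `3 ∣ d − 1` and `81 ∤ d³ + 1 − t³ + 3td`, then `τ³ = 1` on `E[3]`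
(`G³ − 1 = (t² − d)G − (td + 1) ∈ 3·M₂(ℤ₃)`) and `τ³ ≠ 1` on `E[9]` (else `G³ − 1 ∈ 9·M₂(ℤ₃)` and
`81 ∣ det(G³ − 1) = d³ + 1 − t³ + 3td`).
[cite: SilvermanAEC2009, III.§7 (T_ℓ E / ℓⁿ T_ℓ E = E[ℓⁿ])] [cite: SerreAbelianLadic1968, Ch. IV §3.4, Lemma 3 (IV-23)] -/
theorem pow_three_smul_eq_and_exists_ne_of_traceCert [Fact (Nat.Prime 3)]
    (b : Module.Basis (Fin 2) ℤ_[3] (W.tateModule 3)) (τ : absoluteGaloisGroup ℚ) {t d : ℤ}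
    (ht : (LinearMap.toMatrix b b (W.galoisRepTate 3 τ)).trace = (t : ℤ_[3]))
    (hd : (LinearMap.toMatrix b b (W.galoisRepTate 3 τ)).det = (d : ℤ_[3]))
    (ht3 : (3 : ℤ) ∣ t + 1) (hd3 : (3 : ℤ) ∣ d - 1) (h81 : ¬ (81 : ℤ) ∣ d ^ 3 + 1 - t ^ 3 + 3 * t * d) :
    (∀ P ∈ geomTorsion W 3, τ ^ 3 • P = P) ∧ ∃ Q ∈ geomTorsion W 9, τ ^ 3 • Q ≠ Q := by
  set G := LinearMap.toMatrix b b (W.galoisRepTate 3 τ) with hGdef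
  have hG2 : G * G = (t : ℤ_[3]) • G - (d : ℤ_[3]) • (1 : Matrix (Fin 2) (Fin 2) ℤ_[3]) := by
    rw [mat_mul_self_eq' G, ht, hd]
  have hG3 : G ^ 3 - 1 = ((t : ℤ_[3]) * t - d) • G - ((t : ℤ_[3]) * d + 1) • 1 :=
    pow_three_sub_one_eq G hG2
  -- `t = 3 t' - 1`, `d = 3 d' + 1`
  obtain ⟨t', ht'⟩ := ht3
  obtain ⟨d', hd'⟩ := hd3
  have htZ : (t : ℤ_[3]) = 3 * (t' : ℤ_[3]) - 1 := by
    have : t = 3 * t' - 1 := by omega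
    exact_mod_cast congrArg (Int.cast : ℤ → ℤ_[3]) this
  have hdZ : (d : ℤ_[3]) = 3 * (d' : ℤ_[3]) + 1 := by
    have : d = 3 * d' + 1 := by omega
    exact_mod_cast congrArg (Int.cast : ℤ → ℤ_[3]) this
  -- the matrix of `τ³` is `G³ = 1 + 3 X`
  set X : Matrix (Fin 2) (Fin 2) ℤ_[3] :=
    ((3 : ℤ_[3]) * t' * t' - 2 * t' - d') • G - ((3 : ℤ_[3]) * t' * d' + t' - d') • 1 with hXdef
  have hτ3 : LinearMap.toMatrix b b (W.galoisRepTate 3 (τ ^ 3)) = 1 + ((3 : ℕ) : ℤ_[3]) • X := by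
    rw [map_pow, ← LinearMap.toMatrix_pow, ← hGdef, ← sub_eq_iff_eq_add', hG3, hXdef, htZ, hdZ,
      Nat.cast_ofNat, smul_sub, smul_smul, smul_smul]
    module
  refine ⟨fun P hP ↦ smul_eq_of_toMatrix_eq_one_add_smul W 3 b (τ ^ 3) X hτ3 P hP, ?_⟩
  -- if `τ³` fixed `E[9]`, then `81 ∣ det (G³ - 1) = d³ + 1 - t³ + 3 t d`
  by_contra hcon
  push Not at hcon
  have h9 : ∀ Q ∈ geomTorsion W ((3 ^ 2 : ℕ) : ℤ), τ ^ 3 • Q = Q := by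
    intro Q hQ; exact hcon Q (by simpa using hQ)
  have hdvd : ∀ i j, (3 : ℤ_[3]) ^ 2 ∣ (G ^ 3 - 1 : Matrix (Fin 2) (Fin 2) ℤ_[3]) i j := by
    intro i j
    have h := pow_dvd_toMatrix_sub_one_apply_of_forall_smul_eq W 3 b (τ ^ 3) 2 h9 i j
    rwa [map_pow, ← LinearMap.toMatrix_pow, ← hGdef, Nat.cast_ofNat] at h
  have hdet81 : (3 : ℤ_[3]) ^ 4 ∣ (G ^ 3 - 1).det := by
    rw [Matrix.det_fin_two, show (3 : ℤ_[3]) ^ 4 = 3 ^ 2 * 3 ^ 2 by norm_num]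
    exact dvd_sub (mul_dvd_mul (hdvd 0 0) (hdvd 1 1)) (mul_dvd_mul (hdvd 0 1) (hdvd 1 0))
  have hdetZ : (G ^ 3 - 1).det = ((d ^ 3 + 1 - t ^ 3 + 3 * t * d : ℤ) : ℤ_[3]) := by
    rw [hG3, det_smul_sub_smul_one, ht, hd]
    push_cast
    ring
  rw [hdetZ] at hdet81
  exact h81 (int_dvd_of_padicInt_dvd hdet81)

variable [W.IsGloballyMinimal]

/-- **ORDER NINE from one Frobenius, class `(a_ℓ, ℓ) ≡ (2, 1) (mod 3)`**: for `W/ℚ` globally minimal and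
a good prime `ℓ ≡ 1 (mod 3)` with `a_ℓ ≡ 2 (mod 3)` and `81 ∤ ℓ³ + 1 − a_ℓ³ + 3 a_ℓ ℓ` (`= #Ẽ(𝔽_{ℓ³})`),
an arithmetic Frobenius `σ` above `ℓ` has `σ³ = 1` on `E[3]` and `σ³ ≠ 1` on `E[9]` (F0's (h3), (h9)).
[cite: SilvermanAEC2009, C.21 Remark 21.3] [cite: SerreAbelianLadic1968, Ch. IV §3.4, Lemma 3 (IV-23)] -/
theorem exists_orderNine_of_traceCert (ℓ : ℕ) [hℓ : Fact ℓ.Prime]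
    (hgood : W.HasGoodReductionAtPrime ℓ) (hℓ3 : ℓ % 3 = 1) (ha3 : W.frobeniusTrace ℓ % 3 = 2)
    (h81 : ¬ (81 : ℤ) ∣ (ℓ : ℤ) ^ 3 + 1 - W.frobeniusTrace ℓ ^ 3 + 3 * W.frobeniusTrace ℓ * ℓ) :
    ∃ σ : absoluteGaloisGroup ℚ,
      (∀ P ∈ geomTorsion W 3, σ ^ 3 • P = P) ∧ ∃ Q ∈ geomTorsion W 9, σ ^ 3 • Q ≠ Q := by
  haveI : Fact (Nat.Prime 3) := ⟨Nat.prime_three⟩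
  have hp0 : ((3 : ℕ) : ℚ) ≠ 0 := by norm_num
  have hℓne : ℓ ≠ 3 := by omega
  haveI : Module.Free ℤ_[3] (W.tateModule 3) := module_free_tateModule_holds W 3
  haveI : Module.Finite ℤ_[3] (W.tateModule 3) := module_finite_tateModule_holds W 3
  let b : Module.Basis (Fin 2) ℤ_[3] (W.tateModule 3) :=
    Module.finBasisOfFinrankEq ℤ_[3] _ (finrank_tateModule_eq_two_holds W 3 hp0)
  set v : HeightOneSpectrum (𝓞 ℚ) := (primesEquiv (R := 𝓞 ℚ)).symm ⟨ℓ, hℓ.out⟩ with hvdef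
  have hvℓ : (primesEquiv v : ℕ) = ℓ := by rw [hvdef, Equiv.apply_symm_apply]
  obtain ⟨𝔓, h𝔓⟩ := v.primesAbove_nonempty
  obtain ⟨φ, hφ⟩ := HeightOneSpectrum.exists_isArithFrobAt_of_mem_primesAbove_holds (v := v) h𝔓
  have hne : (primesEquiv v : ℕ) ≠ 3 := hvℓ ▸ hℓne
  have hgood' : W.HasGoodReductionAt v :=
    (hasGoodReductionAtPrime_primesEquiv_iff_holds W v ℓ hvℓ).mp hgood
  have htr : (LinearMap.toMatrix b b (W.galoisRepTate 3 φ)).trace = (W.frobeniusTrace ℓ : ℤ_[3]) := by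
    rw [← LinearMap.trace_eq_matrix_trace ℤ_[3] b,
      W.trace_galoisRepTate_frobenius_eq_frobeniusTrace 3 hne hgood' h𝔓 hφ, hvℓ]
  have hdet : (LinearMap.toMatrix b b (W.galoisRepTate 3 φ)).det = ((ℓ : ℤ) : ℤ_[3]) := by
    rw [LinearMap.det_toMatrix, det_galoisRepTate_frobenius_of_hasGoodReductionAt_holds W 3 v
      (natCast_not_mem_asIdeal_of_primesEquiv_ne Nat.prime_three hne) hgood' h𝔓 hφ,
      natCard_residueField_adicCompletionIntegers v, hvℓ, Int.cast_natCast]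
  exact ⟨φ, pow_three_smul_eq_and_exists_ne_of_traceCert W b φ htr hdet (by omega) (by omega) h81⟩

/-- **ORDER NINE from one Frobenius, class `(a_ℓ, ℓ) ≡ (1, 1) (mod 3)`** — witness `φ²` (trace `a_ℓ² − 2ℓ`,
determinant `ℓ²`): if `81 ∤ ℓ⁶ + 1 − (a_ℓ² − 2ℓ)³ + 3 (a_ℓ² − 2ℓ) ℓ²` then some `σ` has (h3), (h9).
[cite: SilvermanAEC2009, C.21 Remark 21.3] [cite: SerreAbelianLadic1968, Ch. IV §3.4, Lemma 3 (IV-23)] -/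
theorem exists_orderNine_of_traceCertSq (ℓ : ℕ) [hℓ : Fact ℓ.Prime]
    (hgood : W.HasGoodReductionAtPrime ℓ) (hℓ3 : ℓ % 3 = 1) (ha3 : W.frobeniusTrace ℓ % 3 = 1)
    (h81 : ¬ (81 : ℤ) ∣ ((ℓ : ℤ) ^ 2) ^ 3 + 1 - (W.frobeniusTrace ℓ ^ 2 - 2 * ℓ) ^ 3 +
      3 * (W.frobeniusTrace ℓ ^ 2 - 2 * ℓ) * (ℓ : ℤ) ^ 2) :
    ∃ σ : absoluteGaloisGroup ℚ,
      (∀ P ∈ geomTorsion W 3, σ ^ 3 • P = P) ∧ ∃ Q ∈ geomTorsion W 9, σ ^ 3 • Q ≠ Q := by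
  haveI : Fact (Nat.Prime 3) := ⟨Nat.prime_three⟩
  have hp0 : ((3 : ℕ) : ℚ) ≠ 0 := by norm_num
  have hℓne : ℓ ≠ 3 := by omega
  haveI : Module.Free ℤ_[3] (W.tateModule 3) := module_free_tateModule_holds W 3
  haveI : Module.Finite ℤ_[3] (W.tateModule 3) := module_finite_tateModule_holds W 3
  let b : Module.Basis (Fin 2) ℤ_[3] (W.tateModule 3) :=
    Module.finBasisOfFinrankEq ℤ_[3] _ (finrank_tateModule_eq_two_holds W 3 hp0)
  set v : HeightOneSpectrum (𝓞 ℚ) := (primesEquiv (R := 𝓞 ℚ)).symm ⟨ℓ, hℓ.out⟩ with hvdef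
  have hvℓ : (primesEquiv v : ℕ) = ℓ := by rw [hvdef, Equiv.apply_symm_apply]
  obtain ⟨𝔓, h𝔓⟩ := v.primesAbove_nonempty
  obtain ⟨φ, hφ⟩ := HeightOneSpectrum.exists_isArithFrobAt_of_mem_primesAbove_holds (v := v) h𝔓
  have hne : (primesEquiv v : ℕ) ≠ 3 := hvℓ ▸ hℓne
  have hgood' : W.HasGoodReductionAt v :=
    (hasGoodReductionAtPrime_primesEquiv_iff_holds W v ℓ hvℓ).mp hgood
  set G := LinearMap.toMatrix b b (W.galoisRepTate 3 φ) with hGdef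
  have htr : G.trace = (W.frobeniusTrace ℓ : ℤ_[3]) := by
    rw [hGdef, ← LinearMap.trace_eq_matrix_trace ℤ_[3] b,
      W.trace_galoisRepTate_frobenius_eq_frobeniusTrace 3 hne hgood' h𝔓 hφ, hvℓ]
  have hdet : G.det = ((ℓ : ℤ) : ℤ_[3]) := by
    rw [hGdef, LinearMap.det_toMatrix, det_galoisRepTate_frobenius_of_hasGoodReductionAt_holds W 3 v
      (natCast_not_mem_asIdeal_of_primesEquiv_ne Nat.prime_three hne) hgood' h𝔓 hφ,
      natCard_residueField_adicCompletionIntegers v, hvℓ, Int.cast_natCast]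
  have hG2 : G * G = (W.frobeniusTrace ℓ : ℤ_[3]) • G - ((ℓ : ℤ) : ℤ_[3]) • 1 := by
    rw [mat_mul_self_eq' G, htr, hdet]
  -- the matrix of `φ²` and its trace / determinant
  have hsq : LinearMap.toMatrix b b (W.galoisRepTate 3 (φ ^ 2)) = G * G := by
    rw [map_pow, ← LinearMap.toMatrix_pow, ← hGdef, pow_two]
  have htr2 : (LinearMap.toMatrix b b (W.galoisRepTate 3 (φ ^ 2))).trace =
      ((W.frobeniusTrace ℓ ^ 2 - 2 * ℓ : ℤ) : ℤ_[3]) := by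
    rw [hsq, trace_mul_self_eq G hG2 htr]
    push_cast
    ring
  have hdet2 : (LinearMap.toMatrix b b (W.galoisRepTate 3 (φ ^ 2))).det = (((ℓ : ℤ) ^ 2 : ℤ) : ℤ_[3]) := by
    rw [hsq, Matrix.det_mul, hdet]
    push_cast
    ring
  -- `3 ∣ (a² - 2ℓ) + 1` and `3 ∣ ℓ² - 1`
  obtain ⟨a', ha'⟩ : ∃ a' : ℤ, W.frobeniusTrace ℓ = 3 * a' + 1 := ⟨W.frobeniusTrace ℓ / 3, by omega⟩
  obtain ⟨l', hl'⟩ : ∃ l' : ℤ, (ℓ : ℤ) = 3 * l' + 1 := ⟨(ℓ : ℤ) / 3, by omega⟩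
  have ht3 : (3 : ℤ) ∣ (W.frobeniusTrace ℓ ^ 2 - 2 * ℓ) + 1 :=
    ⟨3 * a' ^ 2 + 2 * a' - 2 * l', by rw [ha', hl']; ring⟩
  have hd3 : (3 : ℤ) ∣ (ℓ : ℤ) ^ 2 - 1 := ⟨3 * l' ^ 2 + 2 * l', by rw [hl']; ring⟩
  obtain ⟨h3, h9⟩ := pow_three_smul_eq_and_exists_ne_of_traceCert W b (φ ^ 2) htr2 hdet2 ht3 hd3 h81
  refine ⟨φ ^ 2, ?_, ?_⟩
  · intro P hP
    rw [← pow_mul]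
    have := h3 P hP
    rwa [← pow_mul] at this
  · obtain ⟨Q, hQ, hne'⟩ := h9
    refine ⟨Q, hQ, ?_⟩
    rwa [← pow_mul] at hne' ⊢

/-- **The `3`-adic tower from surj(3) and the order-nine trace certificate** (class `(2, 1)`):
F0 `towerSurj_three_of_surj_of_orderNine` fed by `exists_orderNine_of_traceCert`.
[cite: SerreAbelianLadic1968, Ch. IV §3.4, Lemma 3 (IV-23)] [cite: Elkies2006, §1–§2] -/
theorem towerSurj_three_of_surj_of_traceCert (hsurj : W.HasSurjectiveModNGaloisRep 3)
    (ℓ : ℕ) [Fact ℓ.Prime] (hgood : W.HasGoodReductionAtPrime ℓ) (hℓ3 : ℓ % 3 = 1)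
    (ha3 : W.frobeniusTrace ℓ % 3 = 2)
    (h81 : ¬ (81 : ℤ) ∣ (ℓ : ℤ) ^ 3 + 1 - W.frobeniusTrace ℓ ^ 3 + 3 * W.frobeniusTrace ℓ * ℓ)
    (n : ℕ) : W.HasSurjectiveModNGaloisRep (3 ^ n : ℕ) := by
  obtain ⟨σ, h3, h9⟩ := exists_orderNine_of_traceCert W ℓ hgood hℓ3 ha3 h81
  exact towerSurj_three_of_surj_of_orderNine W hsurj σ h3 h9 n

/-- **The `3`-adic tower from surj(3) and the order-nine trace certificate** (class `(1, 1)`, witness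
`φ²`). [cite: SerreAbelianLadic1968, Ch. IV §3.4, Lemma 3 (IV-23)] [cite: Elkies2006, §1–§2] -/
theorem towerSurj_three_of_surj_of_traceCertSq (hsurj : W.HasSurjectiveModNGaloisRep 3)
    (ℓ : ℕ) [Fact ℓ.Prime] (hgood : W.HasGoodReductionAtPrime ℓ) (hℓ3 : ℓ % 3 = 1)
    (ha3 : W.frobeniusTrace ℓ % 3 = 1)
    (h81 : ¬ (81 : ℤ) ∣ ((ℓ : ℤ) ^ 2) ^ 3 + 1 - (W.frobeniusTrace ℓ ^ 2 - 2 * ℓ) ^ 3 +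
      3 * (W.frobeniusTrace ℓ ^ 2 - 2 * ℓ) * (ℓ : ℤ) ^ 2)
    (n : ℕ) : W.HasSurjectiveModNGaloisRep (3 ^ n : ℕ) := by
  obtain ⟨σ, h3, h9⟩ := exists_orderNine_of_traceCertSq W ℓ hgood hℓ3 ha3 h81
  exact towerSurj_three_of_surj_of_orderNine W hsurj σ h3 h9 n

/-- **The order-nine trace certificate READ OFF AN INTEGER MODEL** (class `(2, 1)`): `integralModelInt
W = E₀`, `ℓ ∤ Δ(E₀)`, a kernel point count `#(E₀ mod ℓ)(𝔽_ℓ) = n_ℓ`, `a = ℓ + 1 − n_ℓ`, and the three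
decidable conditions `ℓ ≡ 1 (mod 3)`, `a ≡ 2 (mod 3)`, `81 ∤ ℓ³ + 1 − a³ + 3aℓ` give the tower from
surj(3). [cite: SerreAbelianLadic1968, Ch. IV §3.4, Lemma 3 (IV-23)] [cite: Elkies2006, §1–§2] -/
theorem towerSurj_three_of_intModel_of_traceCert {W : WeierstrassCurve ℚ} [W.IsElliptic]
    [W.IsGloballyMinimal] {E₀ : WeierstrassCurve ℤ} (hI : integralModelInt W = E₀)
    (hsurj : W.HasSurjectiveModNGaloisRep 3) (ℓ : ℕ) [Fact ℓ.Prime] (hΔ : ¬ (ℓ : ℤ) ∣ E₀.Δ) {nℓ : ℕ}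
    (hc : Nat.card ((E₀.map (Int.castRingHom (ZMod ℓ))).toAffine.Point) = nℓ)
    (hℓ3 : ℓ % 3 = 1) (ha3 : ((ℓ : ℤ) + 1 - nℓ) % 3 = 2)
    (h81 : ¬ (81 : ℤ) ∣ (ℓ : ℤ) ^ 3 + 1 - ((ℓ : ℤ) + 1 - nℓ) ^ 3 + 3 * ((ℓ : ℤ) + 1 - nℓ) * ℓ)
    (n : ℕ) : W.HasSurjectiveModNGaloisRep (3 ^ n : ℕ) := by
  have hgood : W.HasGoodReductionAtPrime ℓ :=
    hasGoodReductionAtPrime_of_not_dvd W ℓ (by rw [minimalDiscriminantInt_eq hI]; exact hΔ)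
  have ha : W.frobeniusTrace ℓ = (ℓ : ℤ) + 1 - nℓ := frobeniusTrace_eq hI hc
  exact towerSurj_three_of_surj_of_traceCert W hsurj ℓ hgood hℓ3 (by rw [ha]; exact ha3)
    (by rw [ha]; exact h81) n

/-- **The order-nine trace certificate READ OFF AN INTEGER MODEL** (class `(1, 1)`, witness `φ²`).
[cite: SerreAbelianLadic1968, Ch. IV §3.4, Lemma 3 (IV-23)] [cite: Elkies2006, §1–§2] -/
theorem towerSurj_three_of_intModel_of_traceCertSq {W : WeierstrassCurve ℚ} [W.IsElliptic]
    [W.IsGloballyMinimal] {E₀ : WeierstrassCurve ℤ} (hI : integralModelInt W = E₀)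
    (hsurj : W.HasSurjectiveModNGaloisRep 3) (ℓ : ℕ) [Fact ℓ.Prime] (hΔ : ¬ (ℓ : ℤ) ∣ E₀.Δ) {nℓ : ℕ}
    (hc : Nat.card ((E₀.map (Int.castRingHom (ZMod ℓ))).toAffine.Point) = nℓ)
    (hℓ3 : ℓ % 3 = 1) (ha3 : ((ℓ : ℤ) + 1 - nℓ) % 3 = 1)
    (h81 : ¬ (81 : ℤ) ∣ ((ℓ : ℤ) ^ 2) ^ 3 + 1 - (((ℓ : ℤ) + 1 - nℓ) ^ 2 - 2 * ℓ) ^ 3 +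
      3 * (((ℓ : ℤ) + 1 - nℓ) ^ 2 - 2 * ℓ) * (ℓ : ℤ) ^ 2)
    (n : ℕ) : W.HasSurjectiveModNGaloisRep (3 ^ n : ℕ) := by
  have hgood : W.HasGoodReductionAtPrime ℓ :=
    hasGoodReductionAtPrime_of_not_dvd W ℓ (by rw [minimalDiscriminantInt_eq hI]; exact hΔ)
  have ha : W.frobeniusTrace ℓ = (ℓ : ℤ) + 1 - nℓ := frobeniusTrace_eq hI hc
  exact towerSurj_three_of_surj_of_traceCertSq W hsurj ℓ hgood hℓ3 (by rw [ha]; exact ha3)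
    (by rw [ha]; exact h81) n

/-- **Self-test on Cremona 388800gi1** (`[0, 0, 0, -4860, -97200]`, non-Elkies EXOTIC candidate; `ℓ = 31`:
`#Ẽ(𝔽₃₁) = 24`, `a₃₁ = 8`, `31³ + 1 − 8³ + 3·8·31 = 30024 = 2³·3³·139`): a Frobenius above `31` has ORDER NINE
on `E[9]`; the tower is the tree's `towerSurj3_frob_v388800gi1`. [cite: SerreAbelianLadic1968, Ch. IV §3.4, Lemma 3 (IV-23)] -/
theorem exists_orderNine_v388800gi1 {W : WeierstrassCurve ℚ} [W.IsElliptic] [W.IsGloballyMinimal]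
    (hI : integralModelInt W = ⟨0, 0, 0, -4860, -97200⟩) :
    ∃ σ : absoluteGaloisGroup ℚ,
      (∀ P ∈ geomTorsion W 3, σ ^ 3 • P = P) ∧ ∃ Q ∈ geomTorsion W 9, σ ^ 3 • Q ≠ Q := by
  have hcard : Nat.card (((⟨0, 0, 0, -4860, -97200⟩ : WeierstrassCurve ℤ).map
      (Int.castRingHom (ZMod 31))).toAffine.Point) = 24 := by
    rw [@WeierstrassCurve.natCard_point_eq_one_add_card (ZMod 31) (@ZMod.instField 31 ⟨by norm_num⟩) _ _ _
      (by decide +kernel), @card_sol_eq_sum_euler (ZMod 31) (@ZMod.instField 31 ⟨by norm_num⟩) _ _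
      (by rw [ZMod.ringChar_zmod_n]; decide), ZMod.card]
    decide +kernel
  haveI : Fact (Nat.Prime 31) := ⟨by norm_num⟩
  have hgood : W.HasGoodReductionAtPrime 31 :=
    hasGoodReductionAtPrime_of_not_dvd W 31 (by rw [minimalDiscriminantInt_eq hI]; decide +kernel)
  have ha : W.frobeniusTrace 31 = 8 := by rw [frobeniusTrace_eq hI hcard]; norm_num
  exact exists_orderNine_of_traceCert W 31 hgood (by decide) (by rw [ha]; decide) (by rw [ha]; decide)

end Three

end Summit.BirchSwinnertonDyer.Rank1Residual.GaloisImage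

end
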